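import Mathlib.Analysis.SpecialFunctions.Trigonometric.ArctanDeriv
import Literature.Topology.FourManifolds.TimeDependentFlow
import HarnessLib

/-!
# Uniform local flows are a genuine hypothesis: the field `(1 + x²) d/dx` on `ℝ`

Topic `Literature/Topology/FourManifolds` (fact seat
`provefact-Literature.Topology.FourManifolds.HasUniformLocalFlow`).  The predicate
`Literature.Topology.FourManifolds.HasUniformLocalFlow I V ε` of `TimeDependentFlow.lean` —
"every point has a neighbourhood carrying a smooth local flow of `V` defined for all times in
`(-ε, ε)`" — is the *hypothesis* of the uniform time lemma (Lee, *Introduction to Smooth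
Manifolds* (2012), Lemma 9.15), under which `uflow` is a complete, jointly smooth flow.  It is a
condition on the pair `(V, ε)`, verified in the tree for compact manifolds
(`exists_uniform_localFlow`, `FlowsProofs.lean`), compactly supported fields
(`hasUniformLocalFlow_of_isCompact_support`, `CompactSupportFlow.lean`) and suspension fields
(`hasUniformLocalFlow_suspension`); it is **not** a theorem about all smooth vector fields, and
this file records the standard witness (everything here is proved, no definitions):

* `Literature.Topology.FourManifolds.IsMIntegralCurveOn.hasDerivAt_one_add_sq` — an integral
  curve `γ` of the field `x ↦ 1 + x²` on `ℝ` (a section of the tangent bundle of the model space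
  `ℝ`) on an open interval satisfies `γ' = 1 + γ²` there;
* `Literature.Topology.FourManifolds.not_hasUniformLocalFlow_one_add_sq` — for **every**
  `ε > 0`, `¬ HasUniformLocalFlow 𝓘(ℝ, ℝ) (x ↦ 1 + x²) ε`: along an integral curve `γ` on
  `(-ε, ε)` the function `arctan ∘ γ - id` has zero derivative, so the curve through
  `tan (π/2 - δ)`, `0 < δ < ε`, would satisfy `arctan (γ δ) = π/2`.  (The integral curves are
  the branches of `t ↦ tan (t + c)`, each defined for time `π` only; cf. Lee (2012),
  Example 9.10, the field `x² ∂/∂x` with the integral curve `1 / (1 - t)` through `1`, and the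
  remark opening *Complete Vector Fields*, p. 215: *"not every smooth vector field generates a
  global flow"*.)  No uniqueness of integral curves is needed;
* `Literature.Topology.FourManifolds.exists_contMDiff_not_hasUniformLocalFlow` — packaged: for
  every `ε > 0` there is a smooth vector field on `ℝ` without uniform local flows of time `ε`.

So `ℝ` (Hausdorff, without boundary, complete model) with this smooth field meets every
hypothesis of `Literature.Topology.FourManifolds.uflow` except `HasUniformLocalFlow`, which
therefore cannot be dropped, nor "discharged" uniformly in `V` and `ε`.

## References

* J. M. Lee, *Introduction to Smooth Manifolds*, 2nd ed., GTM 218 (2012), Examples 9.9–9.10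
  (p. 210), *Complete Vector Fields* and Lemma 9.15 (pp. 215–216). [LeeSmoothManifolds2013]
-/

open scoped Manifold ContDiff Topology
open Set Function Filter Real

noncomputable section

namespace Literature.Topology.FourManifolds

-- the tangent spaces of `ℝ` are the model space `ℝ` by definition, which the derivative lemmas
-- must see through (as in Mathlib's `IsMIntegralCurveAt.eventually_hasDerivAt`)
set_option backward.isDefEq.respectTransparency false in
/-- An integral curve `γ` of the field `x ↦ 1 + x²` on `ℝ` on an open interval satisfies
`γ' = 1 + γ²` there (the integral-curve condition read in the trivial chart of `ℝ`). [folklore] -/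
theorem IsMIntegralCurveOn.hasDerivAt_one_add_sq {γ : ℝ → ℝ} {a b t : ℝ}
    (hγ : IsMIntegralCurveOn γ (fun x : ℝ => ((1 : ℝ) + x ^ 2 : TangentSpace 𝓘(ℝ, ℝ) x))
      (Ioo a b)) (ht : t ∈ Ioo a b) :
    HasDerivAt γ (1 + γ t ^ 2) t := by
  have h := (hγ t ht).hasMFDerivAt (Ioo_mem_nhds ht.1 ht.2)
  rw [hasMFDerivAt_iff_hasFDerivAt] at h
  rw [hasDerivAt_iff_hasFDerivAt]
  exact h

/-- The field `x ↦ 1 + x²` is a smooth vector field on `ℝ` (so `ℝ` with this field meets every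
hypothesis of `uflow` except `HasUniformLocalFlow`). [folklore] -/
theorem contMDiff_one_add_sq_section :
    ContMDiff 𝓘(ℝ, ℝ) 𝓘(ℝ, ℝ).tangent ∞ fun x : ℝ =>
      (⟨x, ((1 : ℝ) + x ^ 2 : TangentSpace 𝓘(ℝ, ℝ) x)⟩ : TangentBundle 𝓘(ℝ, ℝ) ℝ) :=
  contMDiff_vectorSpace_iff_contDiff.2 (contDiff_const.add (contDiff_id.pow 2))

/-- **Uniform local flows are a genuine hypothesis.**  The smooth field `(1 + x²) d/dx` on `ℝ`
(Hausdorff, without boundary, complete model) has uniform local flows of time `ε` for **no**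
`ε > 0`: along an integral curve `γ` on `(-ε, ε)` the function `arctan ∘ γ - id` has zero
derivative, hence is constant on `[0, δ]`, so the curve through `tan (π/2 - δ)` (`0 < δ < ε`,
`δ ≤ π/4`) would reach `arctan (γ δ) = π/2` at time `δ`, which is absurd (cf. Lee (2012),
Example 9.10, and p. 215: not every smooth vector field is complete). [folklore] -/
theorem not_hasUniformLocalFlow_one_add_sq {ε : ℝ} (hε : 0 < ε) :
    ¬ HasUniformLocalFlow 𝓘(ℝ, ℝ) (fun x : ℝ => ((1 : ℝ) + x ^ 2 : TangentSpace 𝓘(ℝ, ℝ) x)) ε := by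
  intro hu
  -- a time `δ < ε` with `δ ≤ π / 4`, and the starting point `x₀ = tan (π / 2 - δ)`
  set δ : ℝ := min (ε / 2) (π / 4) with hδ
  have hδ0 : 0 < δ := lt_min (by linarith) (by positivity)
  have hδε : δ < ε := (min_le_left _ _).trans_lt (by linarith)
  have hδπ : δ ≤ π / 4 := min_le_right _ _
  set x₀ : ℝ := tan (π / 2 - δ) with hx₀
  obtain ⟨U, -, hx₀U, Φ, hΦ0, hΦc, -⟩ := hu x₀
  have hγ0 : Φ x₀ 0 = x₀ := hΦ0 x₀ hx₀U
  have hder : ∀ t ∈ Ioo (-ε) ε, HasDerivAt (Φ x₀) (1 + Φ x₀ t ^ 2) t := fun t ht =>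
    IsMIntegralCurveOn.hasDerivAt_one_add_sq (hΦc x₀ hx₀U) ht
  -- `t ↦ arctan (γ t) - t` has zero derivative on `(-ε, ε)`
  have hw : ∀ t ∈ Ioo (-ε) ε, HasDerivAt (fun s => arctan (Φ x₀ s) - s) 0 t := by
    intro t ht
    have hpos : (0 : ℝ) < 1 + Φ x₀ t ^ 2 := by positivity
    have h1 : HasDerivAt (fun s => arctan (Φ x₀ s) - s)
        (1 / (1 + Φ x₀ t ^ 2) * (1 + Φ x₀ t ^ 2) - 1) t :=
      ((hder t ht).arctan).sub (hasDerivAt_id' t)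
    refine h1.congr_deriv ?_
    rw [one_div, inv_mul_cancel₀ hpos.ne', sub_self]
  -- hence it is constant on `[0, δ]`
  have hconst : arctan (Φ x₀ δ) - δ = arctan (Φ x₀ 0) - 0 := by
    refine constant_of_has_deriv_right_zero (f := fun s => arctan (Φ x₀ s) - s)
      (a := 0) (b := δ) (fun s hs => ?_) (fun s hs => ?_) δ ⟨hδ0.le, le_rfl⟩
    · exact (hw s ⟨by linarith [hs.1], lt_of_le_of_lt hs.2 hδε⟩).continuousAt.continuousWithinAt
    · exact (hw s ⟨by linarith [hs.1], lt_trans hs.2 hδε⟩).hasDerivWithinAt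
  -- but `arctan x₀ = π / 2 - δ`, so `arctan (γ δ) = π / 2`: impossible
  have h1 : arctan x₀ = π / 2 - δ :=
    arctan_tan (by linarith [pi_pos]) (by linarith)
  have h2 : arctan (Φ x₀ δ) = π / 2 := by
    rw [hγ0, h1, sub_zero] at hconst
    linarith
  exact (arctan_lt_pi_div_two (Φ x₀ δ)).ne h2

/-- In particular no single time `ε > 0` serves all smooth vector fields, even on the real line:
for every `ε > 0` there is a smooth vector field on `ℝ` without uniform local flows of time `ε`
(so the hypothesis `HasUniformLocalFlow` of `uflow` is not dischargeable uniformly in the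
field). [folklore] -/
theorem exists_contMDiff_not_hasUniformLocalFlow {ε : ℝ} (hε : 0 < ε) :
    ∃ V : Π x : ℝ, TangentSpace 𝓘(ℝ, ℝ) x,
      ContMDiff 𝓘(ℝ, ℝ) 𝓘(ℝ, ℝ).tangent ∞
        (fun x : ℝ => (⟨x, V x⟩ : TangentBundle 𝓘(ℝ, ℝ) ℝ)) ∧
      ¬ HasUniformLocalFlow 𝓘(ℝ, ℝ) V ε :=
  ⟨_, contMDiff_one_add_sq_section, not_hasUniformLocalFlow_one_add_sq hε⟩

end Literature.Topology.FourManifolds
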